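/- Copyright: the b2b-balaban cell (near-miss cell 7), T⁴-continuum fan-out; row NE7b OWNER lineage `t4-ne7b-p1`
(gen 56) — companion of RULING R-OWNER-56-1 ∕ LOCATED MODEL FINDING F-ne7bp1g56-1 and of (ρ1) «THE INDEX READING IS A
COUNT»: «THE PROCESS READS THE FIELD ONLY AT READY LINES».  Released under the licence of the surrounding project. -/
import Summits.QuantumFields.BalabanUV.T4Continuum.Support.HistoryGenealogyLiveIndexSurvivor
import Summits.QuantumFields.BalabanUV.T4Continuum.Support.HistoryGenealogyLineClean

/-!
# «THE PROCESS READS THE FIELD ONLY AT READY LINES»: changing the new-field input off the ready lines changes no live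
line — the kernel form of «a new field inside an unready line is no event» (F-ne7bp1g56-1 (b)) and of «under (ρ0) the
field input is not written on the live index» ((ρ1): field configurations are letters to be COUNTED, not read back)

Summits-side support leaf of the T⁴-continuum cell (rung (B)+1 on a FINITE torus only; NOT infinite volume, NOT the
mass gap, NOT Clay; NOT a proof of NE7b — the cell's OWN estimate, NOT PRINTED, NOT PROVED).  [folklore] finite
combinatorics over print's memory-generic process AS DEFINED in the tree (`HistoryGenealogyInstantiateM`: `RunInputM`,
`RdyM`∕`Fld`∕`AliveM`∕`RnwM`, `vertM`, `blocksM`, `loneOldM`, `newLineM`, `formM`, `StM`, `histM`;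
`HistoryTouchComponents.subset_of_mem_tcomps`; `HistoryGenealogyLineClean.newLineM_of_loneOldM_none∕_some`;
`HistoryGenealogyLiveIndex`: `NoHealing`, the toy `LiveIndexToy.toy`; `…LiveIndexSurvivor`: `toyS`); nothing printed is
asserted, no `def … : Prop` fact of Bałaban's, no cite-tagged hypothesis, zero `sorry`.  B16 = [Balaban1989LargeFieldII]
p. 381 l. 8–13 («the factors arising in the preparatory steps to the R-operation … are connected with components … which
satisfy the conditions (i), (ii)») and p. 385 l. 30 – p. 386 l. 4 are LOCATORS only (owner memo `g56/D5-READ.md` (L5)).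

WHY.  The input of the process carries, besides the new regions `N`, the new-field cubes `F j` of the preparatory
operations; the process consults them ONLY through `Fld j τ` inside `AliveM j τ := ¬ RdyM j τ ∨ Fld j τ` and
`RnwM j τ := RdyM j τ ∧ Fld j τ` — i.e. only on lines READY at `j`.  Two consequences the row's records use by name:
(1) F-ne7bp1g56-1 (b) (R-OWNER-56-1, journal [NE7bP1-G56-RULING1]): a preparatory field placed inside a line that the
TREE holds unready — print's renewal in the gap window `[c + N, t + N)` of a pure join — is NO EVENT: the process is
byte-for-byte the one without that field (`StM_addField_eq`); (2) (ρ1) ∕ R-OWNER-49-1: under (ρ0) `NoHealing` two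
inputs that differ ONLY in their fields have THE SAME live lines at every level up to the cutoff
(`StM_withF_eq_of_noHealing`) — the field configuration is invisible on the live index, so a key read off the live
structures cannot recover it: it is a summation letter to be COUNTED (print p. 383 l. 25–26; the row's
`HistoryBankingFibreCount`), never read back.  The decided toys of R-OWNER-55-1 exhibit the sight exactly: `toyS` IS
`toy` with the field replaced (`toyS_eq_withF`, by `rfl`); their processes agree through level `2`, where no line is yet
ready, and part at level `3`, the field having been READ at the ready level `2` (`field_sight_content`).

WHAT.  §1 `RunInputM.withF` (the input with its field replaced) and its `rfl`-projections; §2 the step: `vertM_withF_eq`,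
`rnwM_withF_iff`, `loneOldM_withF_eq`, `newLineM_withF_eq`, `blocksM_withF_eq`, `formM_withF_eq` — each under «the
fields agree on the READY lines of `prev`»; §3 **`StM_withF_eq`** (fields agreeing on the ready lines of the levels
`< K` ⇒ the same live lines at every level `≤ K`), `comp_withF_eq`, **`StM_addField_eq`** (cubes added off the ready
lines change nothing, all levels), **`StM_withF_eq_of_noHealing`** (two (ρ0)-inputs differing only in the field: same
live lines up to the cutoff); §4 the decided content on the LiveIndex toys: `toyS_eq_withF`, `toy_agree_le_two`,
`toy_StM_three`, **`field_sight_content`**.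

HONEST.  Kernel bookkeeping on OUR process definition; it decides nothing about print's schedule (F-ne7bp1g56-1 is a
READING of [B15] p. 177∕178, [B16] p. 381∕384–386, [III] p. 269 against this definition — memo `g56/D5-READ.md`); BY-NAME
EFFECT ON THE WALL: NONE (information for (ρ0)'s cover rider and (ρ1)'s count); NE7b NOT PRINTED ∕ NOT PROVED; spine
0∕9.  HONEST DEPENDENCY (cell): continuum YM on T⁴ ⇐ BetaPertH ∧ nine spine estimates (0/9 proved); BetaPertH ⇐ (D1) ∧
(D4) ∧ CAP+tail; G-an2-4 gates asym, D1 and NE2/3/4.  This file changes none of it.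
-/

open Finset
open Literature.MathematicalPhysics.QuantumFieldTheory.Balaban1983to89
open Literature.MathematicalPhysics.QuantumFieldTheory.Balaban1983to89.B13ScaleTransfer
open Literature.MathematicalPhysics.QuantumFieldTheory.Balaban1983to89.TreeLength
open Literature.MathematicalPhysics.QuantumFieldTheory.Balaban1983to89.B16SProfile
open Literature.MathematicalPhysics.QuantumFieldTheory.Balaban1983to89.B16MergeGeometry
open Literature.MathematicalPhysics.QuantumFieldTheory.Balaban1983to89.B16StoppingRule
open Summit.QuantumFields.BalabanUV.T4Continuum.HistoryRealise
open Summit.QuantumFields.BalabanUV.T4Continuum.HistoryRealiseMemory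
open Summit.QuantumFields.BalabanUV.T4Continuum.HistoryGenealogyExtraction
open Summit.QuantumFields.BalabanUV.T4Continuum.HistoryGenealogyRealise
open Summit.QuantumFields.BalabanUV.T4Continuum.HistoryTouchComponents

namespace Summit.QuantumFields.BalabanUV.T4Continuum.HistoryGenealogyInstantiate

noncomputable section

open Classical

variable {d : ℕ}

namespace RunInputM

variable (I : RunInputM d) (F' : ℕ → Finset (Pt d))

/-! ## §1 The input with its field replaced -/

/-- **THE INPUT WITH ITS NEW-FIELD CUBES REPLACED** by `F'`: same flow, sizes, memory, regions and classes. [folklore] -/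
def withF : RunInputM d := { I with F := F' }

/-- same blocking [folklore] -/
@[simp] theorem withF_L : (I.withF F').L = I.L := rfl
/-- same exponents [folklore] -/
@[simp] theorem withF_s : (I.withF F').s = I.s := rfl
/-- same sizes [folklore] -/
@[simp] theorem withF_R : (I.withF F').R = I.R := rfl
/-- same memory [folklore] -/
@[simp] theorem withF_Rm : (I.withF F').Rm = I.Rm := rfl
/-- same regions [folklore] -/
@[simp] theorem withF_N : (I.withF F').N = I.N := rfl
/-- same classes [folklore] -/
@[simp] theorem withF_cls : (I.withF F').cls = I.cls := rfl
/-- the replaced field [folklore] -/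
@[simp] theorem withF_F : (I.withF F').F = F' := rfl

/-- readiness does not read the field [folklore] -/
theorem rdyM_withF (j : ℕ) (τ : Line d) : (I.withF F').RdyM j τ ↔ I.RdyM j τ := Iff.rfl

/-- the field predicate of the replaced input [folklore] -/
theorem fld_withF (j : ℕ) (τ : Line d) : (I.withF F').Fld j τ ↔ (τ.D ∩ F' j).Nonempty := Iff.rfl

/-- the vertex images do not read the field [folklore] -/
theorem P_withF (ℓ : ℕ) : (I.withF F').P ℓ = I.P ℓ := rfl

variable {I F'}

/-! ## §2 One step: the field is read only on the ready lines of the previous level -/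

/-- «the fields agree on the READY lines of `prev` at level `j`» — the only place the step reads them [folklore] -/
def FldAgree (I : RunInputM d) (F' : ℕ → Finset (Pt d)) (j : ℕ) (prev : Finset (Line d)) : Prop :=
  ∀ τ ∈ prev, I.RdyM j τ → (I.Fld j τ ↔ (τ.D ∩ F' j).Nonempty)

/-- alive-ness agrees on `prev` [folklore] -/
theorem aliveM_withF_iff {j : ℕ} {prev : Finset (Line d)} (h : FldAgree I F' j prev) {τ : Line d} (hτ : τ ∈ prev) :
    (I.withF F').AliveM j τ ↔ I.AliveM j τ := by
  show (¬ I.RdyM j τ ∨ (τ.D ∩ F' j).Nonempty) ↔ (¬ I.RdyM j τ ∨ I.Fld j τ)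
  by_cases hr : I.RdyM j τ
  · rw [h τ hτ hr]
  · simp [hr]

/-- renewal agrees on `prev` [folklore] -/
theorem rnwM_withF_iff {j : ℕ} {prev : Finset (Line d)} (h : FldAgree I F' j prev) {τ : Line d} (hτ : τ ∈ prev) :
    (I.withF F').RnwM j τ ↔ I.RnwM j τ := by
  show (I.RdyM j τ ∧ (τ.D ∩ F' j).Nonempty) ↔ (I.RdyM j τ ∧ I.Fld j τ)
  exact ⟨fun ⟨hr, hf⟩ => ⟨hr, (h τ hτ hr).2 hf⟩, fun ⟨hr, hf⟩ => ⟨hr, (h τ hτ hr).1 hf⟩⟩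

/-- the vertices of the step agree [folklore] -/
theorem vertM_withF_eq {ℓ : ℕ} {prev : Finset (Line d)} (h : FldAgree I F' (ℓ - 1) prev) :
    (I.withF F').vertM ℓ prev = I.vertM ℓ prev := by
  unfold vertM
  rw [withF_N, Finset.filter_congr fun τ hτ => aliveM_withF_iff h hτ]

/-- the blocks of the step agree [folklore] -/
theorem blocksM_withF_eq {ℓ : ℕ} {prev : Finset (Line d)} (h : FldAgree I F' (ℓ - 1) prev) :
    (I.withF F').blocksM ℓ prev = I.blocksM ℓ prev := by
  unfold blocksM
  rw [vertM_withF_eq h, P_withF]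

/-- an old vertex of a block of the step is a previous line [folklore] -/
theorem mem_prev_of_inl_mem_block {ℓ : ℕ} {prev : Finset (Line d)} {T : Finset (Line d ⊕ Lab d)}
    (hT : T ∈ I.blocksM ℓ prev) {τ : Line d} (hτ : Sum.inl τ ∈ T) : τ ∈ prev :=
  ((I.inl_mem_vertM).1 (subset_of_mem_tcomps hT hτ)).1

/-- the lone-unrenewed-old-line test of a block agrees [folklore] -/
theorem loneOldM_withF_eq {ℓ : ℕ} {prev : Finset (Line d)} (h : FldAgree I F' (ℓ - 1) prev)
    {T : Finset (Line d ⊕ Lab d)} (hT : T ∈ I.blocksM ℓ prev) :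
    (I.withF F').loneOldM ℓ T = I.loneOldM ℓ T := by
  cases hI : I.loneOldM ℓ T with
  | some τ =>
      obtain ⟨rfl, hr⟩ := I.eq_of_loneOldM_eq_some hI
      have hτ : τ ∈ prev := mem_prev_of_inl_mem_block hT (Finset.mem_singleton_self _)
      exact (I.withF F').loneOldM_singleton fun hr' => hr ((rnwM_withF_iff h hτ).1 hr')
  | none =>
      cases hJ : (I.withF F').loneOldM ℓ T with
      | none => rfl
      | some τ =>
          obtain ⟨rfl, hr⟩ := (I.withF F').eq_of_loneOldM_eq_some hJ
          have hτ : τ ∈ prev := mem_prev_of_inl_mem_block hT (Finset.mem_singleton_self _)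
          have hI' := I.loneOldM_singleton (ℓ := ℓ) fun hr' => hr ((rnwM_withF_iff h hτ).2 hr')
          rw [hI'] at hI
          exact absurd hI (by simp)

/-- the new line of a block agrees [folklore] -/
theorem newLineM_withF_eq {ℓ : ℕ} {prev : Finset (Line d)} (h : FldAgree I F' (ℓ - 1) prev)
    {T : Finset (Line d ⊕ Lab d)} (hT : T ∈ I.blocksM ℓ prev) :
    (I.withF F').newLineM ℓ T = I.newLineM ℓ T := by
  cases hI : I.loneOldM ℓ T with
  | some τ =>
      have hJ : (I.withF F').loneOldM ℓ T = some τ := by rw [loneOldM_withF_eq h hT, hI]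
      rw [(I.withF F').newLineM_of_loneOldM_some hJ, I.newLineM_of_loneOldM_some hI, P_withF]
  | none =>
      have hJ : (I.withF F').loneOldM ℓ T = none := by rw [loneOldM_withF_eq h hT, hI]
      rw [(I.withF F').newLineM_of_loneOldM_none hJ, I.newLineM_of_loneOldM_none hI, P_withF]

/-- **THE STEP IS FIELD-BLIND OFF THE READY LINES**: the lines formed at level `ℓ` from `prev` agree. [folklore] -/
theorem formM_withF_eq {ℓ : ℕ} {prev : Finset (Line d)} (h : FldAgree I F' (ℓ - 1) prev) :
    (I.withF F').formM ℓ prev = I.formM ℓ prev := by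
  unfold formM
  rw [blocksM_withF_eq h]
  exact Finset.image_congr fun T hT => newLineM_withF_eq h (Finset.mem_coe.1 hT)

/-! ## §3 The live lines are field-blind off the ready lines -/

/-- **`StM_withF_eq` — THE PROCESS READS THE FIELD ONLY AT READY LINES**: if the two fields agree on every line READY at
a level `j < K` (of the process of `I`), the processes of `I` and of `I.withF F'` have the same live lines at every
level `≤ K`. [folklore] -/
theorem StM_withF_eq (K : ℕ) (hF : ∀ j, j < K → FldAgree I F' j (I.StM j)) :
    ∀ ℓ, ℓ ≤ K → (I.withF F').StM ℓ = I.StM ℓ := by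
  intro ℓ
  induction ℓ with
  | zero =>
      intro _
      rw [StM_eq_formM, StM_eq_formM]
      exact formM_withF_eq fun τ hτ => absurd hτ (Finset.notMem_empty τ)
  | succ ℓ ih =>
      intro hℓ
      rw [StM_eq_formM, StM_eq_formM]
      show (I.withF F').formM (ℓ + 1) ((I.withF F').StM ℓ) = I.formM (ℓ + 1) (I.StM ℓ)
      rw [ih (Nat.le_of_succ_le hℓ)]
      exact formM_withF_eq (by rw [Nat.add_sub_cancel]; exact hF ℓ (Nat.lt_of_succ_le hℓ))

/-- the components (labels of the live lines) agree likewise [folklore] -/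
theorem comp_withF_eq (K : ℕ) (hF : ∀ j, j < K → FldAgree I F' j (I.StM j)) (ℓ : ℕ) (hℓ : ℓ ≤ K) :
    (I.withF F').histM.comp ℓ = I.histM.comp ℓ := by
  show ((I.withF F').StM ℓ).image lab = (I.StM ℓ).image lab
  rw [StM_withF_eq K hF ℓ hℓ]

/-- **«A FIELD OFF THE READY LINES IS NO EVENT»** (F-ne7bp1g56-1 (b)'s sentence in the kernel): adding, at every level
`j`, new-field cubes `X j` DISJOINT FROM EVERY LINE READY AT `j` changes no live line at any level — in particular a
preparatory field inside an unready line leaves the process as it was. [folklore] -/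
theorem StM_addField_eq (X : ℕ → Finset (Pt d)) (hX : ∀ j, ∀ τ ∈ I.StM j, I.RdyM j τ → Disjoint τ.D (X j)) (ℓ : ℕ) :
    (I.withF fun j => I.F j ∪ X j).StM ℓ = I.StM ℓ := by
  refine StM_withF_eq ℓ (fun j _ τ hτ hr => ?_) ℓ le_rfl
  show (τ.D ∩ I.F j).Nonempty ↔ (τ.D ∩ (I.F j ∪ X j)).Nonempty
  rw [Finset.inter_union_distrib_left, Finset.disjoint_iff_inter_eq_empty.1 (hX j τ hτ hr), Finset.union_empty]

/-- **UNDER (ρ0) THE FIELD IS NOT WRITTEN ON THE LIVE INDEX**: two inputs differing ONLY in their new-field cubes that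
both satisfy `NoHealing K` have the same live lines at every level `≤ K` (on a ready line both fields are present —
that is all the process reads). [folklore] -/
theorem StM_withF_eq_of_noHealing (K : ℕ) (hI : I.NoHealing K) (hJ : (I.withF F').NoHealing K) :
    ∀ ℓ, ℓ ≤ K → (I.withF F').StM ℓ = I.StM ℓ := by
  intro ℓ
  induction ℓ using Nat.strong_induction_on with
  | _ ℓ ih =>
      intro hℓ
      refine StM_withF_eq ℓ (fun j hj τ hτ hr => ?_) ℓ le_rfl
      have hτ' : τ ∈ (I.withF F').StM j := by rw [ih j hj (le_trans (Nat.le_of_lt hj) hℓ)]; exact hτ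
      exact ⟨fun _ => hJ j (lt_of_lt_of_le hj hℓ) τ hτ' hr, fun _ => hI j (lt_of_lt_of_le hj hℓ) τ hτ hr⟩

end RunInputM

/-! ## §4 Decided content: the two LiveIndex toys are one input with two fields, read apart at the ready level -/

namespace LiveIndexToy

open RunInputM

/-- **THE SURVIVOR IS THE TOY WITH ITS FIELD REPLACED** (definitionally). [folklore] -/
theorem toyS_eq_withF : toyS = toy.withF O := rfl

/-- before the line is ready (levels `< 2`) the field is not read: the two processes agree through level `2` [folklore] -/
theorem toy_agree_le_two : ∀ ℓ, ℓ ≤ 2 → toyS.StM ℓ = toy.StM ℓ := by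
  rw [toyS_eq_withF]
  refine StM_withF_eq 2 fun j hj τ hτ hr => ?_
  exfalso
  rw [toy.StM_eq_orbitLine toy_N_zero toy_N_pos j (fun i hi => toy_not_stopsM_lt_two i (lt_trans hi hj)),
    Finset.mem_singleton] at hτ
  subst hτ
  exact toy_not_stopsM_lt_two j hj ((toy.rdyM_orbitLine_iff reg.2 j).1 hr)

/-- at level `2` the toy's one line is ready and has no field: it is integrated, and level `3` is EMPTY [folklore] -/
theorem toy_StM_three : toy.StM 3 = ∅ := by
  have h2 : toy.StM 2 = {toy.orbitLine reg.2 2} :=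
    toy.StM_eq_orbitLine toy_N_zero toy_N_pos 2 toy_not_stopsM_lt_two
  have hdead : ¬ toy.AliveM 2 (toy.orbitLine reg.2 2) := by
    rw [toy.aliveM_iff_imp]
    intro h
    have hf := h ((toy.rdyM_orbitLine_iff reg.2 2).2 toy_stopsM_two)
    simp [RunInput.Fld, toy] at hf
  have hv : toy.vertM 3 (toy.StM 2) = ∅ := by
    rw [vertM, h2, Finset.filter_singleton, if_neg hdead, Finset.image_empty, Finset.empty_union,
      toy_N_pos 3 (by norm_num), Finset.image_empty]
  rw [StM_eq_formM, PrevM, formM, blocksM, hv]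
  simp [tcomps]

/-- **CONTENT — THE FIELD IS READ EXACTLY AT THE READY LEVEL**: the toy (`F ≡ ∅`) and the survivor (`F := O`) are ONE
input with two fields (`toyS = toy.withF O`); their live lines AGREE through level `2` (no line ready before `2`) and
DIFFER at level `3` (at the ready level `2` the survivor's field renews the line, the toy's absence integrates it).
[folklore] -/
theorem field_sight_content :
    toyS = toy.withF O ∧ (∀ ℓ, ℓ ≤ 2 → toyS.StM ℓ = toy.StM ℓ) ∧ toyS.StM 3 ≠ toy.StM 3 :=
  ⟨toyS_eq_withF, toy_agree_le_two, fun h =>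
    Finset.not_nonempty_empty ((toy_StM_three ▸ h) ▸ StM_toyS_nonempty 3)⟩

end LiveIndexToy

end

end Summit.QuantumFields.BalabanUV.T4Continuum.HistoryGenealogyInstantiate
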